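import Literature.Computability.QuantumComplexity.HadamardTestBig
import HarnessLib

/-!
# One Hadamard-test copy of the AJL circuit: the block circuit and its statistics

Topic `Literature/Computability/QuantumComplexity`; a step in the discharge of
`ajl_jonesApproxProblem_mem_PromiseBQP`. The block of one trial (AJL §3.3, Algorithm
Approximate-Jones-Trace: "apply the Hadamard test to `|α⟩` and `Q(b)`"): the Hadamard-test circuit
of `HadamardTestBig.lean` around the word circuit of `WordCircuit.lean`,
`copyCircuit hG im = hadTestCircuit q (wordCircuit hG) im`. On a basis input clean on the kit,
table-consistent with the letters `β`, with the test qubit off, it implements the Hadamard-test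
operator of `U = placeGate E (ajlPosCoreMatrix (wordOf β))` up to `wordErr`
(`copyCircuit_implOn`), so the test qubit reads `0` with probability within `wordErr` of
`(1 + Re(s · (ajlPosCoreMatrix b)_{pp}))/2`, `p` the content of the path register
(`copyCircuit_prob`); with `p = encodePos (ajlAlpha n)` this matrix element has modulus
`ajlRatio 5 n b` (`JonesLocalGate.norm_ajlPosCoreMatrix_apply_encodePos`).

## References

* D. Aharonov, V. Jones, Z. Landau, Algorithmica 55 (2009), §2.2, §3.3 (Algorithm
  Approximate-Jones-Trace), Claim 4.1, Thm. 4.3 [AharonovJonesLandau2009].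
-/

noncomputable section

namespace Literature.Computability.QuantumComplexity

open _root_.Matrix Finset Cryptography
open scoped Matrix.Norms.L2Operator

variable {N n r : ℕ}

namespace WordGeom

variable {G : WordGeom N n r} (hG : G.OK)

/-- **The circuit of one Hadamard-test copy** (`im`: imaginary-part trial). [cite: AharonovJonesLandau2009, §3.3] -/
def copyCircuit (im : Bool) : QCircuit cliffordT N := hadTestCircuit G.q (wordCircuit hG) im

/-- The ideal unitary of the copy: the placed core matrix of the word. [cite: AharonovJonesLandau2009, §3.2] -/
def coreU (G : WordGeom N n r) (β : Fin r → Option (Fin (n - 1) × Bool)) : Matrix (QReg N) (QReg N) ℂ :=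
  placeGate G.E (ajlPosCoreMatrix (wordOf β))

/-- The clean-input condition of a copy: kit clean and table spelling `β`. [folklore] -/
def Pcopy (G : WordGeom N n r) (β : Fin r → Option (Fin (n - 1) × Bool)) : Set (QReg N) := G.kit.P ∩ G.TableSet β

include hG

/-- The test qubit is not a kit or table wire: membership in `Pcopy` ignores it. [folklore] -/
theorem update_q_mem_Pcopy (β : Fin r → Option (Fin (n - 1) × Bool)) (x : QReg N) (b : Bool) :
    Function.update x G.q b ∈ G.Pcopy β ↔ x ∈ G.Pcopy β := by
  have h1 : G.q ∉ G.kit.cr :: G.kit.as ++ G.kit.region := by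
    rw [List.cons_append, List.mem_cons, List.mem_append, not_or, not_or]
    have h := hG.q_had; rw [List.mem_cons, not_or] at h
    exact ⟨h.1, h.2, GadgetKit.not_mem_region_of_lt hG.kit hG.q_lt⟩
  simp only [Pcopy, GadgetKit.P, Set.mem_inter_iff, update_mem_cleanOn_iff h1, update_mem_cleanOn_iff hG.q_hs, TableSet, Set.mem_setOf_eq]
  refine and_congr_right fun _ => forall₂_congr fun s p => ?_
  rw [Function.update_of_ne (hG.q_tw s p).symm]

/-- The core unitary does not touch the test qubit. [folklore] -/
theorem coreU_apply_eq_zero (β : Fin r → Option (Fin (n - 1) × Bool)) (x z : QReg N) (h : x G.q ≠ z G.q) : G.coreU β x z = 0 :=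
  placeGate_apply_eq_zero_of_ne G.E _ hG.q_E x z h

omit hG in
/-- The core unitary is unitary. [folklore] -/
theorem coreU_mem_unitaryGroup (β : Fin r → Option (Fin (n - 1) × Bool)) : G.coreU β ∈ Matrix.unitaryGroup (QReg N) ℂ :=
  placeGate_mem_unitaryGroup_holds _ (ajlPosCoreMatrix_mem_unitaryGroup _)

/-- The core unitary preserves the clean-input condition. [folklore] -/
theorem preservesSupp_coreU (β : Fin r → Option (Fin (n - 1) × Bool)) : PreservesSupp (G.Pcopy β) (G.coreU β) :=
  (preservesSupp_placeGate_E_kitP hG _).inter (preservesSupp_placeGate_E_table hG β _)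

/-- **The copy circuit implements the Hadamard-test operator of `Q(b)`** on clean, table-consistent
inputs, up to `wordErr`. [cite: AharonovJonesLandau2009, §3.3 and Claim 4.1] -/
theorem copyCircuit_implOn (β : Fin r → Option (Fin (n - 1) × Bool)) (im : Bool) :
    ImplOn (G.Pcopy β) ((copyCircuit hG im).toMatrix 0) (hadTestOp G.q (G.coreU β) (phaseOf im)) (wordErr n r G.kit.k) :=
  hadTestCircuit_implOn (update_q_mem_Pcopy hG β) (coreU_mem_unitaryGroup β) (coreU_apply_eq_zero hG β) (preservesSupp_coreU hG β)
    (by unfold wordErr GadgetKit.letterErr GadgetKit.rotErr GadgetKit.phaseErr; positivity) (wordCircuit_implOn hG β) im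

/-- The copy circuit is oracle-free. [folklore] -/
theorem copyCircuit_isOracleFree (im : Bool) : (copyCircuit hG im).IsOracleFree := by
  refine hadTestCircuit_isOracleFree G.q (fun g hg => ?_) im
  obtain ⟨C, hC, hg⟩ := mem_of_mem_chainCircuit_gates _ hg
  rw [List.mem_map] at hC
  obtain ⟨s, -, rfl⟩ := hC
  obtain ⟨C', hC', hg'⟩ := mem_of_mem_chainCircuit_gates _ hg
  rw [List.mem_map] at hC'
  obtain ⟨p, -, rfl⟩ := hC'
  -- a letter circuit: five OAA words of sandwich / reflection circuits
  simp only [GadgetKit.letterCircuit, QCircuit.append, List.mem_append] at hg'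
  have hword : ∀ {z sgn : ℤ} (hz : z = 2 ∨ z = 3) (hs : sgn = 1 ∨ sgn = -1), g ∈ (GadgetKit.rotWord hG.kit (hG.letter s p) hz hs).gates → g.IsOracleFree :=
    fun hz hs h => oaaWordCircuit_isOracleFree (sandwichCircuit_isOracleFree _ _ _ _ _ _ _ _) (reflectCircuit_isOracleFree _ _ _ _ _) g h
  have hph : g ∈ (GadgetKit.phaseWord hG.kit (hG.letter s p) p.2).gates → g.IsOracleFree :=
    fun h => oaaWordCircuit_isOracleFree (phaseSandwichCircuit_isOracleFree _ _ _ _ _) (reflectCircuit_isOracleFree _ _ _ _ _) g h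
  rcases hg' with (((h | h) | h) | h) | h
  · exact hword _ _ h
  · exact hword _ _ h
  · exact hph h
  · exact hword _ _ h
  · exact hword _ _ h

/-- **The statistics of one copy**: on a basis input in `Pcopy β` with the test qubit off, the test
qubit reads `0` with probability within `wordErr` of `(1 + Re(s · Q(b)_{pp}))/2`, where
`p = x₀ ∘ E` is the content of the path register and `s = phaseOf im`.
[cite: AharonovJonesLandau2009, §2.2, §3.3 and Thm. 4.3] -/
theorem copyCircuit_prob (β : Fin r → Option (Fin (n - 1) × Bool)) (im : Bool) {x₀ : QReg N} (hx₀ : x₀ ∈ G.Pcopy β) (hx : x₀ G.q = false) :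
    |(∑ y ∈ Finset.univ.filter (fun y : QReg N => y G.q = false), ‖((copyCircuit hG im).toMatrix 0 *ᵥ basisState x₀) y‖ ^ 2) -
      (1 + (phaseOf im * ajlPosCoreMatrix (wordOf β) (x₀ ∘ G.E) (x₀ ∘ G.E)).re) / 2| ≤ wordErr n r G.kit.k := by
  have h := hadTestCircuit_prob (update_q_mem_Pcopy hG β) (coreU_mem_unitaryGroup β) (coreU_apply_eq_zero hG β) (preservesSupp_coreU hG β)
    (by unfold wordErr GadgetKit.letterErr GadgetKit.rotErr GadgetKit.phaseErr; positivity) (wordCircuit_implOn hG β) im hx₀ hx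
  have e : G.coreU β (Function.update x₀ G.q true) (Function.update x₀ G.q true) = ajlPosCoreMatrix (wordOf β) (x₀ ∘ G.E) (x₀ ∘ G.E) := by
    rw [coreU, placeGate_apply, if_pos (fun _ _ => rfl)]
    have : Function.update x₀ G.q true ∘ G.E = x₀ ∘ G.E := funext fun j => Function.update_of_ne (fun hh => hG.q_E ⟨j, hh⟩) ..
    rw [this]
  rw [e] at h
  exact h

/-- **The Hadamard-test operator of a copy preserves the clean-input condition.** [folklore] -/
theorem preservesSupp_hadTestOp (β : Fin r → Option (Fin (n - 1) × Bool)) (s : ℂ) : PreservesSupp (G.Pcopy β) (hadTestOp G.q (G.coreU β) s) := by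
  rw [hadTestOp]
  exact ((preservesSupp_hOn (update_q_mem_Pcopy hG β)).mul ((preservesSupp_diagonal _ _).mul (preservesSupp_condOn _ (preservesSupp_coreU hG β)))).mul
    (preservesSupp_hOn (update_q_mem_Pcopy hG β))

end WordGeom

end Literature.Computability.QuantumComplexity

end
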